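import Literature.AlgebraicGeometry.Motives.PushforwardKunnethFormula
import Literature.AlgebraicGeometry.Motives.HodgeConjectureDominatedVarieties
import Literature.AlgebraicGeometry.Motives.GaloisRepresentationsDominatedVarieties
import HarnessLib

/-!
# Domination is transitive, reflexive on isomorphisms and multiplicative; equal Betti numbers

Throughout the descent files of this series a smooth projective `U` (`dim U = M`) is *dominated*
by `V` (`dim V = N = M + r`) through `f : V ⟶ U` when `f₊ ζ ≠ 0` for some rational algebraic class
`ζ ∈ Aʳ(V)_ℚ` — the hypothesis of Kleiman 1968 Prop. 1.2.4 / Kahn 2020 Lemma 6.30 (2) (a linear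
section of `V` generically finite over `U`), under which `f*` is injective and `f₊ (f* x ∪ ζ) = q x`.
This file closes the relation up:

* **transitivity** (`pushforward_comp_pullback_cup`, `pushforward_comp_ne_zero`): if `U` is
  dominated by `V` through `(f, ζ)` and `V` by `Y` through `(g, ξ)`, then `U` is dominated by `Y`
  through `(g ≫ f, g* ζ ∪ ξ)`: `(g ≫ f)₊ (g* ζ ∪ ξ) = f₊ g₊ (g* ζ ∪ ξ) = f₊ (ζ ∪ g₊ ξ) = q' f₊ ζ`
  (`(g ≫ f)₊ = f₊ ∘ g₊`, Kahn 2020 Example 3.47, and the projection formula §3.5.1);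
* **isomorphisms dominate** (`pullback_bijective_of_isIso`, `pushforward_one_ne_zero_of_isIso`):
  `f*` is bijective for an isomorphism `f`, so `f₊` — its Poincaré transpose — is injective and
  `f₊ 1 ≠ 0`;
* **products**: `U₁ × U₂` is dominated by `V₁ × V₂` (`PushforwardKunnethFormula`), whence Tate's
  conjecture, Tate semisimplicity, the Hodge conjecture and the Riemann hypothesis descend from
  `V₁ × V₂` to `U₁ × U₂` (`tateConjectureFor_tensor_of_pushforward_ne_zero`, …, assembling the
  one-map descent theorems of `TateConjectureDominatedVarieties`,
  `GaloisRepresentationsDominatedVarieties`, `HodgeConjectureDominatedVarieties`,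
  `FrobeniusDominatedVarieties`);
* **equal Betti numbers**: if `U` is dominated by `V` and `bᵢ(U) = bᵢ(V)` then
  `f* : Hⁱ(U) ⥲ Hⁱ(V)` is bijective (`pullback_bijective_of_pushforward_ne_zero_of_finrank_eq`);
  mutually dominated varieties have equal Betti numbers; and over a finite field
  **`Pᵢ(U, T) = Pᵢ(V, T)`** (`frobCharPoly_eq_of_pullback_injective_of_finrank_eq`: a monic divisor
  of the same degree, `Pᵢ(U) ∣ Pᵢ(V)` being `frobCharPoly_dvd_of_pullback_injective`), e.g. for a
  morphism of non-zero degree between varieties with the same Betti numbers (isogenies).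

Theorems only (no definition, no named fact, no instance).

## References

* [Kleiman1968AlgebraicCycles] S. Kleiman, *Algebraic cycles and the Weil conjectures*, in: Dix
  exposés sur la cohomologie des schémas (1968), §1.2 Prop. 1.2.4, §1.3.
* [Kahn2020] B. Kahn, *Zeta and L-functions of varieties and motives*, LMS Lecture Note Ser. 462
  (2020), §3.5.1 (projection formula), §3.5.3 Example 3.47, §6.9 Lemma 6.30 (2), Thm. 6.31 (3).
* [Deligne1974] P. Deligne, *La conjecture de Weil. I*, Publ. Math. IHÉS 43 (1974), (1.5.4), Thm. (1.6).
* [Tate1994] J. Tate, *Conjectures on algebraic cycles in ℓ-adic cohomology* (Seattle 1991),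
  Proc. Sympos. Pure Math. 55.1 (1994), §1.
* [VoisinHodgeI2002] C. Voisin, *Hodge theory and complex algebraic geometry I* (2002), §11.3
  Conj. 11.24, Lemma 7.28.
-/

universe u v

open CategoryTheory AlgebraicGeometry MonoidalCategory CartesianMonoidalCategory Polynomial

noncomputable section

namespace Literature.AlgebraicGeometry.Motives

namespace WeilCohomology

variable {k : Type u} [Field k] {K : Type v} [Field K] [CharZero K] (W : WeilCohomology k K)

/-! ## Transitivity -/

section Transitivity

variable {L N M r s : ℕ} {Y V U : SchemeOver k}

/-- `g* ζ ∪ ξ ∈ A^{r+s}(Y)_ℚ` for `ζ ∈ Aʳ(V)_ℚ`, `ξ ∈ Aˢ(Y)_ℚ`, `g : Y ⟶ V` (axioms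
`pullback_ratAlgebraicClasses_le`, `cup_mem_ratAlgebraicClasses`; Kleiman 1968 §1.2 (C)).
[cite: Kleiman1968AlgebraicCycles, §1.2 (C)] -/
theorem cup_pullback_mem_ratAlgebraicClasses (hY : IsSmoothProjective L Y)
    (hV : IsSmoothProjective N V) (g : Y ⟶ V) {ζ : W.obj V (2 * r)}
    (hζ : ζ ∈ W.ratAlgebraicClasses V r) {ξ : W.obj Y (2 * s)} (hξ : ξ ∈ W.ratAlgebraicClasses Y s)
    (h : 2 * r + 2 * s = 2 * (r + s)) :
    W.cup h (W.pullback g (2 * r) ζ) ξ ∈ W.ratAlgebraicClasses Y (r + s) :=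
  W.cup_mem_ratAlgebraicClasses hY rfl _ _ (W.pullback_ratAlgebraicClasses_le hY hV g r ⟨ζ, hζ, rfl⟩)
    hξ

/-- **`(g ≫ f)₊ (g* ζ ∪ ξ) = q' · f₊ ζ`** when `g₊ ξ = q' · 1_V` (`g : Y ⟶ V`, `f : V ⟶ U`,
`dim Y = L = N + s`, `dim V = N = M + r`): `(g ≫ f)₊ = f₊ ∘ g₊` (Kahn 2020 Example 3.47) and
`g₊ (g* ζ ∪ ξ) = ζ ∪ g₊ ξ = q' ζ` (projection formula, §3.5.1).
[cite: Kahn2020, §3.5.1 and §3.5.3 Example 3.47] -/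
theorem pushforward_comp_pullback_cup (hY : IsSmoothProjective L Y) (hV : IsSmoothProjective N V)
    (hU : IsSmoothProjective M U) (g : Y ⟶ V) (f : V ⟶ U) (ζ : W.obj V (2 * r))
    (he : 2 * r + 2 * M = 2 * N) (hd : 0 + 2 * M = 2 * M) {ξ : W.obj Y (2 * s)}
    {he' : 2 * s + 2 * N = 2 * L} {hd' : 0 + 2 * N = 2 * N} {q' : ℚ}
    (hq' : W.pushforward (N := L) hV g he' hd' ξ = (q' : K) • W.one V)
    (h : 2 * r + 2 * s = 2 * (r + s)) (he'' : 2 * (r + s) + 2 * M = 2 * L) :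
    W.pushforward (N := L) hU (g ≫ f) he'' hd (W.cup h (W.pullback g (2 * r) ζ) ξ) =
      (q' : K) • W.pushforward (N := N) hU f he hd ζ := by
  rw [W.pushforward_comp hV hU g f he'' he hd, LinearMap.comp_apply,
    W.pushforward_pullback_cup hY hV g h he'' he he' hd' (Nat.add_zero _) ζ ξ, hq', map_smul,
    W.cup_one hV (Nat.add_zero _), map_smul]

/-- **Domination is transitive**: if `f₊ ζ ≠ 0` (`ζ ∈ Aʳ(V)_ℚ`) and `g₊ ξ ≠ 0` (`ξ ∈ Aˢ(Y)_ℚ`),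
then `(g ≫ f)₊ (g* ζ ∪ ξ) ≠ 0`, with `g* ζ ∪ ξ ∈ A^{r+s}(Y)_ℚ`
(`cup_pullback_mem_ratAlgebraicClasses`): `U` dominated by `V` dominated by `Y` ⇒ `U` dominated by
`Y` (Kahn 2020 Lemma 6.30 (2); Kleiman 1968 Prop. 1.2.4).
[cite: Kahn2020, §6.9 Lemma 6.30 (2)] [cite: Kleiman1968AlgebraicCycles, §1.2 Prop. 1.2.4] -/
theorem pushforward_comp_ne_zero (hY : IsSmoothProjective L Y) (hV : IsSmoothProjective N V)
    (hU : IsSmoothProjective M U) (g : Y ⟶ V) (f : V ⟶ U) {ζ : W.obj V (2 * r)}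
    {he : 2 * r + 2 * M = 2 * N} {hd : 0 + 2 * M = 2 * M}
    (hne : W.pushforward (N := N) hU f he hd ζ ≠ 0) {ξ : W.obj Y (2 * s)}
    (hξ : ξ ∈ W.ratAlgebraicClasses Y s) {he' : 2 * s + 2 * N = 2 * L} {hd' : 0 + 2 * N = 2 * N}
    (hne' : W.pushforward (N := L) hV g he' hd' ξ ≠ 0) (h : 2 * r + 2 * s = 2 * (r + s))
    (he'' : 2 * (r + s) + 2 * M = 2 * L) :
    W.pushforward (N := L) hU (g ≫ f) he'' hd (W.cup h (W.pullback g (2 * r) ζ) ξ) ≠ 0 := by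
  obtain ⟨q', hq'⟩ := W.exists_pushforward_eq_ratCast_smul_one hY hV g hξ he' hd'
  have hq0 : (q' : K) ≠ 0 := fun h0 ↦ hne' (by rw [hq', h0, zero_smul])
  rw [W.pushforward_comp_pullback_cup hY hV hU g f ζ he hd hq' h he'']
  exact smul_ne_zero hq0 hne

end Transitivity

/-! ## Isomorphisms -/

section Iso

variable {N M : ℕ} {V U : SchemeOver k}

/-- `f*` is bijective in every degree for an isomorphism `f` (`(f⁻¹)* ∘ f* = id = f* ∘ (f⁻¹)*`).
[cite: Kleiman1968AlgebraicCycles, §1.2] -/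
theorem pullback_bijective_of_isIso (f : V ⟶ U) [IsIso f] (i : ℕ) :
    Function.Bijective (W.pullback f i) := by
  have h₁ : W.pullback (inv f) i ∘ₗ W.pullback f i = LinearMap.id := by
    rw [← W.pullback_comp, IsIso.inv_hom_id, W.pullback_id]
  have h₂ : W.pullback f i ∘ₗ W.pullback (inv f) i = LinearMap.id := by
    rw [← W.pullback_comp, IsIso.hom_inv_id, W.pullback_id]
  refine ⟨Function.LeftInverse.injective (g := W.pullback (inv f) i) fun x ↦ ?_,
    Function.RightInverse.surjective (g := W.pullback (inv f) i) fun x ↦ ?_⟩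
  · exact LinearMap.congr_fun h₁ x
  · exact LinearMap.congr_fun h₂ x

/-- **An isomorphism dominates**: `f₊ 1 ≠ 0` for an isomorphism `f : V ⟶ U` of smooth projective
varieties of dimension `N` (`f₊` is injective as the Poincaré transpose of the surjective `f*`,
`pushforward_injective_iff`; and `1 ≠ 0`). With `1 ∈ A⁰(V)_ℚ` this is the domination hypothesis
for `r = 0`. [cite: Kahn2020, §3.5.1] -/
theorem pushforward_one_ne_zero_of_isIso (hV : IsSmoothProjective N V) (hU : IsSmoothProjective N U)
    (f : V ⟶ U) [IsIso f] (he : 2 * 0 + 2 * N = 2 * N) (hd : 0 + 2 * N = 2 * N) :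
    W.pushforward (N := N) hU f he hd (W.one V) ≠ 0 := fun h ↦ by
  have hinj := (W.pushforward_injective_iff hV hU f he hd).mpr
    (W.pullback_bijective_of_isIso f (2 * N)).surjective
  exact W.unit_ne_zero hV (hinj (by rw [h, map_zero]))

end Iso

/-! ## Equal Betti numbers -/

section Betti

variable {N M r : ℕ} {V U : SchemeOver k}

/-- **`f*` is bijective on `Hⁱ` when it is injective and `bᵢ(U) = bᵢ(V)`** (finite-dimensional
linear algebra). [cite: Kleiman1968AlgebraicCycles, §1.2 Prop. 1.2.4] -/
theorem pullback_bijective_of_injective_of_finrank_eq (hV : IsSmoothProjective N V)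
    (hU : IsSmoothProjective M U) (f : V ⟶ U) {i : ℕ} (hinj : Function.Injective (W.pullback f i))
    (hrank : Module.finrank K (W.obj U i) = Module.finrank K (W.obj V i)) :
    Function.Bijective (W.pullback f i) := by
  haveI := W.finite_obj hV i
  haveI := W.finite_obj hU i
  exact ⟨hinj, (LinearMap.injective_iff_surjective_of_finrank_eq_finrank hrank).mp hinj⟩

/-- **`f* : Hⁱ(U) ⥲ Hⁱ(V)` is bijective for `U` dominated by `V` with `bᵢ(U) = bᵢ(V)`**
(`f*` injective, Kleiman 1968 Prop. 1.2.4). [cite: Kleiman1968AlgebraicCycles, §1.2 Prop. 1.2.4] -/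
theorem pullback_bijective_of_pushforward_ne_zero_of_finrank_eq (hV : IsSmoothProjective N V)
    (hU : IsSmoothProjective M U) (f : V ⟶ U) {ζ : W.obj V (2 * r)}
    (hζ : ζ ∈ W.ratAlgebraicClasses V r) {he : 2 * r + 2 * M = 2 * N} {hd : 0 + 2 * M = 2 * M}
    (hne : W.pushforward (N := N) hU f he hd ζ ≠ 0) {i : ℕ}
    (hrank : Module.finrank K (W.obj U i) = Module.finrank K (W.obj V i)) :
    Function.Bijective (W.pullback f i) :=
  W.pullback_bijective_of_injective_of_finrank_eq hV hU f
    (W.pullback_injective_of_pushforward_ne_zero hV hU f hζ hne i) hrank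

variable {N' r' : ℕ}

/-- **Mutually dominated varieties have the same Betti numbers**: if `U` is dominated by `V`
(through `f : V ⟶ U`) and `V` by `U` (through `f' : U ⟶ V`), then `bᵢ(U) = bᵢ(V)`
(`bᵢ(U) ≤ bᵢ(V) ≤ bᵢ(U)`, Kleiman 1968 Prop. 1.2.4). [cite: Kleiman1968AlgebraicCycles, §1.2 Prop. 1.2.4] -/
theorem finrank_eq_of_pushforward_ne_zero_of_pushforward_ne_zero (hV : IsSmoothProjective N V)
    (hU : IsSmoothProjective M U) (f : V ⟶ U) {ζ : W.obj V (2 * r)}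
    (hζ : ζ ∈ W.ratAlgebraicClasses V r) {he : 2 * r + 2 * M = 2 * N} {hd : 0 + 2 * M = 2 * M}
    (hne : W.pushforward (N := N) hU f he hd ζ ≠ 0) (f' : U ⟶ V) {ζ' : W.obj U (2 * r')}
    (hζ' : ζ' ∈ W.ratAlgebraicClasses U r') {hf' : 2 * r' + 2 * N = 2 * M} {hd'' : 0 + 2 * N = 2 * N}
    (hne' : W.pushforward (N := M) hV f' hf' hd'' ζ' ≠ 0) (i : ℕ) :
    Module.finrank K (W.obj U i) = Module.finrank K (W.obj V i) :=
  le_antisymm (W.finrank_le_of_pushforward_ne_zero hV hU f hζ hne i)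
    (W.finrank_le_of_pushforward_ne_zero hU hV f' hζ' hne' i)

end Betti

/-! ## Products of dominations: the algebraic classes -/

section Products

variable {N₁ N₂ M₁ M₂ r₁ r₂ : ℕ} {V₁ V₂ U₁ U₂ : SchemeOver k}

/-- **`Aᵖ(U₁ × U₂)_ℚ = (f × g)₊ A^{p+r₁+r₂}(V₁ × V₂)_ℚ`** for `U₁`, `U₂` dominated by `V₁`, `V₂`
(`map_pushforward_ratAlgebraicClasses_eq` for the product domination `(f × g)₊ (ζ₁ × ζ₂) ≠ 0`).
Degrees: `p + r₁ + r₂ = a`, `2a + c = 2(N₁ + N₂)`, `2p + c = 2(M₁ + M₂)`.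
[cite: Kahn2020, §6.9 Lemma 6.30 (2)] [cite: Kleiman1968AlgebraicCycles, §1.3] -/
theorem map_pushforward_tensorHom_ratAlgebraicClasses_eq (hV₁ : IsSmoothProjective N₁ V₁)
    (hV₂ : IsSmoothProjective N₂ V₂) (hU₁ : IsSmoothProjective M₁ U₁)
    (hU₂ : IsSmoothProjective M₂ U₂) (f : V₁ ⟶ U₁) (g : V₂ ⟶ U₂) {ζ₁ : W.obj V₁ (2 * r₁)}
    (hζ₁ : ζ₁ ∈ W.ratAlgebraicClasses V₁ r₁) {he₁ : 2 * r₁ + 2 * M₁ = 2 * N₁}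
    {hd₁ : 0 + 2 * M₁ = 2 * M₁} (hne₁ : W.pushforward (N := N₁) hU₁ f he₁ hd₁ ζ₁ ≠ 0)
    {ζ₂ : W.obj V₂ (2 * r₂)} (hζ₂ : ζ₂ ∈ W.ratAlgebraicClasses V₂ r₂)
    {he₂ : 2 * r₂ + 2 * M₂ = 2 * N₂} {hd₂ : 0 + 2 * M₂ = 2 * M₂}
    (hne₂ : W.pushforward (N := N₂) hU₂ g he₂ hd₂ ζ₂ ≠ 0) {p a c : ℕ} (ha : p + (r₁ + r₂) = a)
    (he : 2 * a + c = 2 * (N₁ + N₂)) (hd : 2 * p + c = 2 * (M₁ + M₂)) :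
    (W.ratAlgebraicClasses (V₁ ⊗ V₂) a).map
        (W.pushforward (N := N₁ + N₂) (IsSmoothProjective.tensor_holds hU₁ hU₂) (f ⊗ₘ g)
          he hd).toAddMonoidHom =
      W.ratAlgebraicClasses (U₁ ⊗ U₂) p :=
  W.map_pushforward_ratAlgebraicClasses_eq (IsSmoothProjective.tensor_holds hV₁ hV₂)
    (IsSmoothProjective.tensor_holds hU₁ hU₂) (f ⊗ₘ g)
    (W.externalCup_mem_ratAlgebraicClasses hV₁ hV₂ rfl (by omega) hζ₁ hζ₂)
    (W.pushforward_tensorHom_externalCup_ne_zero hV₁ hV₂ hU₁ hU₂ f g hζ₁ hne₁ hζ₂ hne₂ (by omega)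
      (by omega) (by omega)) ha he hd

end Products

end WeilCohomology

/-! ## Products of dominations: Tate, semisimplicity, Riemann hypothesis -/

namespace GaloisWeilCohomology

variable {k : Type u} [Field k] {K : Type v} [Field K] [CharZero K]
  {χ : Field.absoluteGaloisGroup k →* Kˣ} (E : GaloisWeilCohomology k K χ)
variable {N M N₁ N₂ M₁ M₂ r r₁ r₂ : ℕ} {V U V₁ V₂ U₁ U₂ : SchemeOver k}

/-- **`Tᵖ(V₁ × V₂) ⇒ Tᵖ(U₁ × U₂)`** when `U₁` is dominated by `V₁` and `U₂` by `V₂` (Tate's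
conjecture descends along the product domination `(f × g)₊ (ζ₁ × ζ₂) ≠ 0`; Tate 1994 §1 with
Kleiman 1968 Prop. 1.2.4). [cite: Tate1994, §1 (Conjecture Tᵖ)] [cite: Kleiman1968AlgebraicCycles, §1.2 Prop. 1.2.4] -/
theorem tateConjectureFor_tensor_of_pushforward_ne_zero (hV₁ : IsSmoothProjective N₁ V₁)
    (hV₂ : IsSmoothProjective N₂ V₂) (hU₁ : IsSmoothProjective M₁ U₁)
    (hU₂ : IsSmoothProjective M₂ U₂) (f : V₁ ⟶ U₁) (g : V₂ ⟶ U₂) {ζ₁ : E.obj V₁ (2 * r₁)}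
    (hζ₁ : ζ₁ ∈ E.ratAlgebraicClasses V₁ r₁) {he₁ : 2 * r₁ + 2 * M₁ = 2 * N₁}
    {hd₁ : 0 + 2 * M₁ = 2 * M₁} (hne₁ : E.pushforward (N := N₁) hU₁ f he₁ hd₁ ζ₁ ≠ 0)
    {ζ₂ : E.obj V₂ (2 * r₂)} (hζ₂ : ζ₂ ∈ E.ratAlgebraicClasses V₂ r₂)
    {he₂ : 2 * r₂ + 2 * M₂ = 2 * N₂} {hd₂ : 0 + 2 * M₂ = 2 * M₂}
    (hne₂ : E.pushforward (N := N₂) hU₂ g he₂ hd₂ ζ₂ ≠ 0) {p : ℕ}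
    (hT : E.TateConjectureFor (V₁ ⊗ V₂) p) : E.TateConjectureFor (U₁ ⊗ U₂) p :=
  E.tateConjectureFor_of_pushforward_ne_zero (IsSmoothProjective.tensor_holds hV₁ hV₂)
    (IsSmoothProjective.tensor_holds hU₁ hU₂) (f ⊗ₘ g)
    (E.externalCup_mem_ratAlgebraicClasses hV₁ hV₂ rfl (by omega) hζ₁ hζ₂)
    (E.pushforward_tensorHom_externalCup_ne_zero hV₁ hV₂ hU₁ hU₂ f g hζ₁ hne₁ hζ₂ hne₂ (by omega)
      (by omega) (by omega)) hT

/-- **`Sⁱ(V₁ × V₂) ⇒ Sⁱ(U₁ × U₂)`** (Tate semisimplicity descends along the product domination: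
`Hⁱ(U₁ × U₂) ↪ Hⁱ(V₁ × V₂)` is a subrepresentation). [cite: Tate1994, §1] [cite: Kleiman1968AlgebraicCycles, §1.2 Prop. 1.2.4] -/
theorem tateSemisimplicityFor_tensor_of_pushforward_ne_zero (hV₁ : IsSmoothProjective N₁ V₁)
    (hV₂ : IsSmoothProjective N₂ V₂) (hU₁ : IsSmoothProjective M₁ U₁)
    (hU₂ : IsSmoothProjective M₂ U₂) (f : V₁ ⟶ U₁) (g : V₂ ⟶ U₂) {ζ₁ : E.obj V₁ (2 * r₁)}
    (hζ₁ : ζ₁ ∈ E.ratAlgebraicClasses V₁ r₁) {he₁ : 2 * r₁ + 2 * M₁ = 2 * N₁}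
    {hd₁ : 0 + 2 * M₁ = 2 * M₁} (hne₁ : E.pushforward (N := N₁) hU₁ f he₁ hd₁ ζ₁ ≠ 0)
    {ζ₂ : E.obj V₂ (2 * r₂)} (hζ₂ : ζ₂ ∈ E.ratAlgebraicClasses V₂ r₂)
    {he₂ : 2 * r₂ + 2 * M₂ = 2 * N₂} {hd₂ : 0 + 2 * M₂ = 2 * M₂}
    (hne₂ : E.pushforward (N := N₂) hU₂ g he₂ hd₂ ζ₂ ≠ 0) {i : ℕ}
    (hS : E.TateSemisimplicityFor (V₁ ⊗ V₂) i) : E.TateSemisimplicityFor (U₁ ⊗ U₂) i :=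
  E.tateSemisimplicityFor_of_pushforward_ne_zero (IsSmoothProjective.tensor_holds hV₁ hV₂)
    (IsSmoothProjective.tensor_holds hU₁ hU₂) (f ⊗ₘ g)
    (E.externalCup_mem_ratAlgebraicClasses hV₁ hV₂ rfl (by omega) hζ₁ hζ₂)
    (E.pushforward_tensorHom_externalCup_ne_zero hV₁ hV₂ hU₁ hU₂ f g hζ₁ hne₁ hζ₂ hne₂ (by omega)
      (by omega) (by omega)) hS

section Frobenius

variable [Finite k]

/-- **`RH(V₁ × V₂) ⇒ RH(U₁ × U₂)` over a finite field**, given integral models of the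
`Pᵢ(U₁ × U₂, T)` (rationality): the Frobenius polynomials of `U₁ × U₂` divide those of `V₁ × V₂`
(`(f × g)*` injective; Deligne 1974 (1.5.4), Thm. (1.6)). [cite: Deligne1974, Thm. (1.6)]
[cite: Kleiman1968AlgebraicCycles, §1.2 Prop. 1.2.4] -/
theorem weilRiemannHypothesisFor_tensor_of_pushforward_ne_zero (hV₁ : IsSmoothProjective N₁ V₁)
    (hV₂ : IsSmoothProjective N₂ V₂) (hU₁ : IsSmoothProjective M₁ U₁)
    (hU₂ : IsSmoothProjective M₂ U₂) (f : V₁ ⟶ U₁) (g : V₂ ⟶ U₂) {ζ₁ : E.obj V₁ (2 * r₁)}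
    (hζ₁ : ζ₁ ∈ E.ratAlgebraicClasses V₁ r₁) {he₁ : 2 * r₁ + 2 * M₁ = 2 * N₁}
    {hd₁ : 0 + 2 * M₁ = 2 * M₁} (hne₁ : E.pushforward (N := N₁) hU₁ f he₁ hd₁ ζ₁ ≠ 0)
    {ζ₂ : E.obj V₂ (2 * r₂)} (hζ₂ : ζ₂ ∈ E.ratAlgebraicClasses V₂ r₂)
    {he₂ : 2 * r₂ + 2 * M₂ = 2 * N₂} {hd₂ : 0 + 2 * M₂ = 2 * M₂}
    (hne₂ : E.pushforward (N := N₂) hU₂ g he₂ hd₂ ζ₂ ≠ 0)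
    (hint : ∀ i : Fin (2 * (M₁ + M₂) + 1), ∃ P : ℤ[X], E.IsIntegralModel (U₁ ⊗ U₂) i P)
    (hRH : E.WeilRiemannHypothesisFor (V₁ ⊗ V₂) (N₁ + N₂)) :
    E.WeilRiemannHypothesisFor (U₁ ⊗ U₂) (M₁ + M₂) :=
  E.weilRiemannHypothesisFor_of_pushforward_ne_zero (IsSmoothProjective.tensor_holds hV₁ hV₂)
    (IsSmoothProjective.tensor_holds hU₁ hU₂) (f ⊗ₘ g)
    (E.externalCup_mem_ratAlgebraicClasses hV₁ hV₂ rfl (by omega) hζ₁ hζ₂)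
    (E.pushforward_tensorHom_externalCup_ne_zero hV₁ hV₂ hU₁ hU₂ f g hζ₁ hne₁ hζ₂ hne₂ (by omega)
      (by omega) (by omega)) hint hRH

/-! ## Equal Betti numbers: `Pᵢ(U, T) = Pᵢ(V, T)` -/

/-- **`det(T - F | Hⁱ(U)) = det(T - F | Hⁱ(V))`** when `f* : Hⁱ(U) → Hⁱ(V)` is injective and
`bᵢ(U) = bᵢ(V)`: the first characteristic polynomial divides the second
(`charpoly_frobAction_dvd_of_pullback_injective`, Bourbaki VIII § 20 n° 6) and both are monic of
degree `bᵢ`. [cite: Deligne1974, (1.5.4)] [cite: BourbakiAlgebreVIII2012, VIII § 20 n° 6 (p. 377)] -/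
theorem charpoly_frobAction_eq_of_pullback_injective_of_finrank_eq (hV : IsSmoothProjective N V)
    (hU : IsSmoothProjective M U) (f : V ⟶ U) {i : ℕ} (hinj : Function.Injective (E.pullback f i))
    (hrank : Module.finrank K (E.obj U i) = Module.finrank K (E.obj V i)) :
    (haveI := E.finite_obj hU i; (E.frobAction U i).charpoly) =
      (haveI := E.finite_obj hV i; (E.frobAction V i).charpoly) := by
  haveI := E.finite_obj hU i
  haveI := E.finite_obj hV i
  refine (Polynomial.eq_of_monic_of_dvd_of_natDegree_le (E.frobAction U i).charpoly_monic
    (E.frobAction V i).charpoly_monic (E.charpoly_frobAction_dvd_of_pullback_injective hV hU f hinj)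
    ?_).symm
  rw [LinearMap.charpoly_natDegree, LinearMap.charpoly_natDegree, hrank]

/-- **`Pᵢ(U, T) = Pᵢ(V, T)`** (`Pᵢ = det(1 - T·F | Hⁱ)`) when `f* : Hⁱ(U) → Hⁱ(V)` is injective and
`bᵢ(U) = bᵢ(V)` (reversal of `charpoly_frobAction_eq_of_pullback_injective_of_finrank_eq`;
Deligne 1974 (1.5.4)). [cite: Deligne1974, (1.5.4)] -/
theorem frobCharPoly_eq_of_pullback_injective_of_finrank_eq (hV : IsSmoothProjective N V)
    (hU : IsSmoothProjective M U) (f : V ⟶ U) {i : ℕ} (hinj : Function.Injective (E.pullback f i))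
    (hrank : Module.finrank K (E.obj U i) = Module.finrank K (E.obj V i)) :
    E.frobCharPoly U i = E.frobCharPoly V i := by
  rw [E.frobCharPoly_eq hU i, E.frobCharPoly_eq hV i,
    E.charpoly_frobAction_eq_of_pullback_injective_of_finrank_eq hV hU f hinj hrank]

/-- **`Pᵢ(U, T) = Pᵢ(V, T)` for `U` dominated by `V` with `bᵢ(U) = bᵢ(V)`** (`f*` injective,
Kleiman 1968 Prop. 1.2.4; e.g. a morphism of non-zero degree between varieties with the same
Betti numbers). [cite: Deligne1974, (1.5.4)] [cite: Kleiman1968AlgebraicCycles, §1.2 Prop. 1.2.4] -/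
theorem frobCharPoly_eq_of_pushforward_ne_zero_of_finrank_eq (hV : IsSmoothProjective N V)
    (hU : IsSmoothProjective M U) (f : V ⟶ U) {ζ : E.obj V (2 * r)}
    (hζ : ζ ∈ E.ratAlgebraicClasses V r) {he : 2 * r + 2 * M = 2 * N} {hd : 0 + 2 * M = 2 * M}
    (hne : E.pushforward (N := N) hU f he hd ζ ≠ 0) {i : ℕ}
    (hrank : Module.finrank K (E.obj U i) = Module.finrank K (E.obj V i)) :
    E.frobCharPoly U i = E.frobCharPoly V i :=
  E.frobCharPoly_eq_of_pullback_injective_of_finrank_eq hV hU f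
    (E.pullback_injective_of_pushforward_ne_zero hV hU f hζ hne i) hrank

variable {r' : ℕ}

/-- **Mutually dominated varieties have the same Frobenius polynomials**: if `U` is dominated by
`V` and `V` by `U` then `Pᵢ(U, T) = Pᵢ(V, T)` for every `i` (equal Betti numbers,
`finrank_eq_of_pushforward_ne_zero_of_pushforward_ne_zero`), hence — granted the trace formula —
the same zeta function. [cite: Deligne1974, (1.5.4)] [cite: Kleiman1968AlgebraicCycles, §1.2 Prop. 1.2.4] -/
theorem frobCharPoly_eq_of_pushforward_ne_zero_of_pushforward_ne_zero (hV : IsSmoothProjective N V)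
    (hU : IsSmoothProjective M U) (f : V ⟶ U) {ζ : E.obj V (2 * r)}
    (hζ : ζ ∈ E.ratAlgebraicClasses V r) {he : 2 * r + 2 * M = 2 * N} {hd : 0 + 2 * M = 2 * M}
    (hne : E.pushforward (N := N) hU f he hd ζ ≠ 0) (f' : U ⟶ V) {ζ' : E.obj U (2 * r')}
    (hζ' : ζ' ∈ E.ratAlgebraicClasses U r') {hf' : 2 * r' + 2 * N = 2 * M}
    {hd'' : 0 + 2 * N = 2 * N} (hne' : E.pushforward (N := M) hV f' hf' hd'' ζ' ≠ 0) (i : ℕ) :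
    E.frobCharPoly U i = E.frobCharPoly V i :=
  E.frobCharPoly_eq_of_pushforward_ne_zero_of_finrank_eq hV hU f hζ hne
    (E.finrank_eq_of_pushforward_ne_zero_of_pushforward_ne_zero hV hU f hζ hne f' hζ' hne' i)

end Frobenius

end GaloisWeilCohomology

/-! ## Products of dominations: the Hodge conjecture -/

namespace BettiHodgeData

variable {k : Type} [Field k] [Algebra k ℂ] (B : BettiHodgeData k)
variable {N₁ N₂ M₁ M₂ r₁ r₂ : ℕ} {V₁ V₂ U₁ U₂ : SchemeOver k}

/-- **`HC(V₁ × V₂, p) ⇒ HC(U₁ × U₂, p)`** when `U₁` is dominated by `V₁` and `U₂` by `V₂` (the Hodge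
conjecture descends along the product domination `(f × g)₊ (ζ₁ × ζ₂) ≠ 0`: a Hodge class on
`U₁ × U₂` pulls back to a Hodge class on `V₁ × V₂`, Voisin I Lemma 7.28, and descends,
`hodgeConjectureFor_of_pushforward_ne_zero`). [cite: VoisinHodgeI2002, §11.3 Conj. 11.24 and Lemma 7.28]
[cite: Kleiman1968AlgebraicCycles, §1.2 Prop. 1.2.4] -/
theorem hodgeConjectureFor_tensor_of_pushforward_ne_zero (hV₁ : IsSmoothProjective N₁ V₁)
    (hV₂ : IsSmoothProjective N₂ V₂) (hU₁ : IsSmoothProjective M₁ U₁)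
    (hU₂ : IsSmoothProjective M₂ U₂) (hV : IsSmoothProjective (N₁ + N₂) (V₁ ⊗ V₂))
    (hU : IsSmoothProjective (M₁ + M₂) (U₁ ⊗ U₂)) (f : V₁ ⟶ U₁) (g : V₂ ⟶ U₂)
    {ζ₁ : B.W.obj V₁ (2 * r₁)} (hζ₁ : ζ₁ ∈ B.W.ratAlgebraicClasses V₁ r₁)
    {he₁ : 2 * r₁ + 2 * M₁ = 2 * N₁} {hd₁ : 0 + 2 * M₁ = 2 * M₁}
    (hne₁ : B.W.pushforward (N := N₁) hU₁ f he₁ hd₁ ζ₁ ≠ 0) {ζ₂ : B.W.obj V₂ (2 * r₂)}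
    (hζ₂ : ζ₂ ∈ B.W.ratAlgebraicClasses V₂ r₂) {he₂ : 2 * r₂ + 2 * M₂ = 2 * N₂}
    {hd₂ : 0 + 2 * M₂ = 2 * M₂} (hne₂ : B.W.pushforward (N := N₂) hU₂ g he₂ hd₂ ζ₂ ≠ 0) {p : ℕ}
    (hH : B.HodgeConjectureFor hV p) : B.HodgeConjectureFor hU p :=
  B.hodgeConjectureFor_of_pushforward_ne_zero hV hU (f ⊗ₘ g)
    (B.W.externalCup_mem_ratAlgebraicClasses hV₁ hV₂ rfl (by omega) hζ₁ hζ₂)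
    (B.W.pushforward_tensorHom_externalCup_ne_zero hV₁ hV₂ hU₁ hU₂ f g hζ₁ hne₁ hζ₂ hne₂ (by omega)
      (by omega) (by omega)) hH

end BettiHodgeData

end Literature.AlgebraicGeometry.Motives
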